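import Summits.FinalStateConjecture.FinalStateConjecture.Theses.BondiDrainDispersal
import Summits.FinalStateConjecture.FinalStateConjecture.Theorems.BondiDrainDispersalHorizonlessMustDrainNormalForm
import Literature.Geometry.Lorentzian.KissingBallsCutMass
import Literature.Geometry.Lorentzian.CompleteDevelopmentMaximal
import Summits.FinalStateConjecture.FinalStateConjecture.Theorems.BondiDrainDispersalHorizonlessMustDrainMinkowskiConeSection
import Summits.FinalStateConjecture.FinalStateConjecture.Theorems.BondiDrainDispersalHorizonlessMustDrainMinkowskiSphereSection
import Summits.FinalStateConjecture.FinalStateConjecture.Theorems.BondiDrainDispersalHorizonlessMustDrainMinkowskiSectionArea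
import Summits.FinalStateConjecture.FinalStateConjecture.Theorems.BondiDrainDispersalHorizonlessMustDrainMinkowskiSectionGauss
import Summits.FinalStateConjecture.FinalStateConjecture.Theorems.BondiDrainDispersalHorizonlessMustDrainMinkowskiSectionNullExpansion
import Summits.FinalStateConjecture.FinalStateConjecture.Theorems.BondiDrainDispersalHorizonlessMustDrainHasVanishingFinalBondiMassTransport
import Summits.FinalStateConjecture.FinalStateConjecture.Theorems.PhaseMixingCaptureWeakCosmicCensorshipMGHDCompleteNullInfinityInvariant
import Summits.FinalStateConjecture.FinalStateConjecture.Theorems.BondiDrainDispersalHorizonlessMustDrainMinkowskiNoHorizon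
import Summits.FinalStateConjecture.FinalStateConjecture.Theorems.BondiDrainDispersalHorizonlessMustDrainNoHorizonTransport
import Literature.Geometry.Lorentzian.GeodesicIncompleteness
import Summits.FinalStateConjecture.FinalStateConjecture.Theorems.BondiDrainDispersalHorizonlessMustDrainNoHorizonOfFutureNullComplete
import Summits.FinalStateConjecture.FinalStateConjecture.Theorems.BondiDrainDispersalHorizonlessMustDrainScriCompleteOfFutureNullComplete
import Summits.FinalStateConjecture.FinalStateConjecture.Theorems.BondiDrainDispersalHorizonlessMustDrainLogicTier
import Literature.Geometry.Lorentzian.IdealPoints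
import Summits.FinalStateConjecture.FinalStateConjecture.Theorems.BondiDrainDispersalHorizonlessMustDrainNoSingleViewpoint
import Summits.FinalStateConjecture.FinalStateConjecture.Theorems.BondiDrainDispersalHorizonlessMustDrainHiddenOfNaked
import Summits.FinalStateConjecture.FinalStateConjecture.Theorems.BondiDrainDispersalHorizonlessMustDrainIncompleteSectorFibre
import Summits.FinalStateConjecture.FinalStateConjecture.Theorems.BondiDrainDispersalHorizonlessMustDrainTrappedHorizon
import HarnessLib

/-!
# Birth skeleton — crux stmt-FinalStateConjecture-9976 `Theses.BondiDrainDispersal.HorizonlessMustDrain` (rank 4)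
# line `birth` (skeleton registrar planner-skel-stmt-FinalStateConjecture-9976-0, 2026-08-17; BC3 of run/shared/lean/lens3/_common/BC.md)

THE CRUX (fixed; the route's decl and signature, never restated here): for every admissible datum `D`,
every maximal vacuum Cauchy development `𝒟` of `D` with complete future null infinity (sojourn form)
and NO EVENT HORIZON in the ray-theoretic sense (it is false that some event `q` lies outside the
chronological past `I⁻(γ(dom ∩ [0,∞)))` of every future-complete normalised null ray `γ` from the
data hypersurface) has vanishing final Bondi mass
(`CauchyDevelopment.HasVanishingFinalBondiMass`, CutBondiMass.lean, definition N1) — "a censored,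
horizonless vacuum development radiates away all of its mass", the no-soliton theorem at `𝓘⁺`.

THE REGISTERED SKELETON SINCE LEAD c5 (2026-08-17, equivalence form): registered stubs `stub_completeSector`
("every future causally geodesically complete MGHD of an admissible datum has vanishing final Bondi mass",
open-problem sized) and `stub_incompleteSector` ("every censored, horizonless, NOT future causally complete MGHD
of an admissible datum has vanishing final Bondi mass", expected vacuous by censorship, L/XL), composition
`HorizonlessMustDrain_of : Sig.stub_completeSector → Sig.stub_incompleteSector → HorizonlessMustDrain` by excluded
middle on completeness (`horizonlessMustDrain_iff_sectors`, landed p157550) — an EQUIVALENCE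
(`horizonlessMustDrain_iff_stubs`): each stub is implied by the crux, so a refutation of either refutes the crux.
The historical cut below (C, L; then C1, L) survives as proved glue: L ↔ completeSector, C1 ⇒ C ⇒ incompleteSector,
(★) ⇒ C1.

THE CUT (Penrose's completeness dichotomy as the midpoint; the currency in which the route's cited
rigidity theorem — Anderson 2000, Thm. 0.1 = `Literature.Geometry.Lorentzian.Anderson2000_completeStationaryVacuumFlat`,
"geodesically complete stationary vacuum ⇒ flat" — is stated is GEODESIC COMPLETENESS, not
horizonlessness, so any line through Lichnerowicz–Anderson must convert "no horizon" into
"no singularity" somewhere; the skeleton makes that conversion the first stub and the Liouville /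
no-soliton theorem in completeness currency the second):

* `stub_horizonlessComplete` (C, CENSORED + HORIZONLESS ⇒ FUTURE CAUSALLY GEODESICALLY COMPLETE; size L/XL,
  causal geometry of the MGHD): for every admissible `D` and every MGHD `𝒟` with complete `𝓘⁺` (sojourn
  form) and no event horizon (ray-theoretic, verbatim the crux's hypothesis), `𝒟` is future causally
  geodesically complete — no maximal future-directed null or timelike geodesic has affine domain bounded
  above (`¬ IsFutureNullGeodesicallyIncomplete ∧ ¬ IsFutureTimelikeGeodesicallyIncomplete`, the
  predicate of route NoParkingWithoutHorizon, verbatim).  "Weak cosmic censorship + no black hole ⇒ no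
  singularity at all": an incomplete future causal geodesic of an MGHD runs into the future boundary of
  the MGHD (curvature blow-up or Cauchy horizon); if every event before it is visible from a
  future-complete ray, the boundary's null generators reach the asymptotic region and cut the far
  INGOING rays at bounded sojourn time in `J⁺(ιB₀)`, contradicting the sojourn clause — unless the
  boundary piece is trapped, in which case its past neighbourhood is invisible and there IS a horizon.
  Why it might fail: the sojourn clause only constrains rays starting far out, so a compact, non-spreading
  piece of MGHD boundary all of whose past points still escape to infinity would be a "censored yet
  visible" incompleteness; the ray-theoretic horizon predicate is too weak if an exotic interior carries a
  future-complete ray from `X` (the route's standing typing caveat); provability: `IsMaximal` is abstract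
  (no boundary / TIP structure of MGHDs in the prelude yet).  Sources: Penrose1965; HawkingEllis1973 §9.2
  (future asymptotic predictability) and §8.2; Wald1984 §12.1; Christodoulou1999 (CQG 16 A23, pp. A26–A27);
  DafermosLuk2017 (incompleteness hidden behind `𝓗⁺`); arXiv:0811.0354 §2.6.2.
* `stub_completeMustDrain` (L, FUTURE-COMPLETE CENSORED VACUUM DEVELOPMENTS DRAIN — the no-soliton theorem
  in Anderson's currency; open-problem sized, the load-bearing stub): for every admissible `D` and every
  MGHD `𝒟` with complete `𝓘⁺` which is future causally geodesically complete, the final Bondi mass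
  vanishes.  Intended mechanism (route header, TWO-LAYER PLAN for this crux): Bondi mass loss + positivity
  give finite radiated energy, hence quiet windows of growing length; quantitative unique continuation
  from `𝓘⁺` (arXiv:1312.1989, AlexakisSchlue2018) makes the development approximately stationary on them;
  completeness lets the late-time limits be complete stationary chronological vacuum spacetimes, which are
  flat (Anderson2000 Thm 0.1 — the named fact above, to be taken as a hypothesis `(h : Anderson2000_…)` by
  the prover), so no mass can be parked: `M_B ↓ 0`.  Shared in substance with route
  NoParkingWithoutHorizon's crux `CompleteSpacetimesDisperse` (complete ⇒ `N = 0` decomposition), from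
  which it follows once "honest `N = 0` `C²` decomposition ⇒ vanishing final Bondi mass" is proved.
  Why it might fail: an eternal FUTURE-COMPLETE vacuum breather / geon with complete `𝓘⁺` and
  `M_B ↓ M_∞ > 0` (only stationary — Anderson2000 — and time-periodic-near-`𝓘⁺` — AlexakisSchlue2018,
  BicakScholtzTod2010 — solitons are excluded); a complete regular "black-hole mimicker" with an event
  horizon and positive final mass; limits of quiet windows need compactness (bounded geometry) that
  completeness alone may not give.  Sources: Anderson2000 (doi:10.1007/PL00001021, Thm 0.1);
  AlexakisSchlue2018 (arXiv:1504.04592, Thm 1.1); BicakScholtzTod2010; arXiv:1312.1989;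
  ChristodoulouKlainerman1993 (Ch. 17, mass loss, `M(−∞) = 0`); Christodoulou1991 (spherical
  Einstein–scalar: `M_∞ > 0` ⇒ black hole); SchoenYau1982, LudvigsenVickers1982 (positivity).

Composition `HorizonlessMustDrain_of : Sig.stub_horizonlessComplete → Sig.stub_completeMustDrain →
HorizonlessMustDrain` (the `Sig.*` legend = the stub signatures verbatim as named propositions, so that the
implication's hypotheses are the registered stubs BY NAME and its conclusion the crux BY NAME), and
`horizonlessMustDrain_of_stubs : HorizonlessMustDrain` closed modulo the two registered stubs (which is also the
kernel check that each `Sig.stub_x` is literally the type of `stub_x`).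
Neither stub is the crux or the summit in costume: C has a different conclusion (geodesic completeness,
not Bondi mass) and is not implied by the crux; L replaces the horizon hypothesis by completeness (a
transfer to the currency of the rigidity theorem the line consumes; incomparable with the crux, and
wanted in substance by a second route).  BC3 probes (`stub → HorizonlessMustDrain`, `stub →
FinalStateConjecture` by `first | exact? | simpa [·] | (unfold ·; simpa) | aesop`) are recorded in the
registrar's NOTES.md.  Disproof.lean: none exists for this crux (`ledger crux ls stmt-FinalStateConjecture-9976`:
no workfiles at registration), so there is no `_false_without_` obligation to honour and no landed Negative
lemma to check the stubs against.  Negatives index (`ledger negatives --problem FinalStateConjecture`, 1 entry,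
`not_UniformPhotonSphereChannels`): an ODE channel estimate, unrelated to either stub.
-/

set_option linter.dupNamespace false

noncomputable section

open scoped Manifold ContDiff Topology
open Filter Set Function Literature.Geometry.Lorentzian

namespace Summit.FinalStateConjecture.FinalStateConjecture.Cruxes.HorizonlessMustDrain.Birth

open Summit.FinalStateConjecture.FinalStateConjecture.Theses.BondiDrainDispersal (HorizonlessMustDrain)

/-! ## Legend: the stub statements as named propositions (verbatim the registered signatures)

The skeleton audit (`ledger skeleton check` / `#h21_check_skeleton`) admits as hypotheses of the concluding theorem
only propositions referred to BY NAME whose last name component is a declared stub; `Sig.stub_x` is verbatim the type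
of `stub_x`, and `horizonlessMustDrain_of_stubs` below is the kernel check that the two agree.

RESHAPE OF LEAD c5 (2026-08-17, equivalence form).  The registered stubs are now the two SECTORS of the crux —
`stub_completeSector` and `stub_incompleteSector` — for which `crux ↔ completeSector ∧ incompleteSector` is already certified
in the tree (`horizonlessMustDrain_iff_sectors`, LogicTier, p157550): each registered stub is IMPLIED by the crux, so a
`stub-false` on either one refutes the crux itself (no spurious line death), and a `promote-stub` names exactly the statement the
planners were asked to file.  The earlier registered stubs C1 (`Sig.stub_incompletenessHidden_of_scriComplete`) and L
(`Sig.stub_completeMustDrain`) stay in the legend as propositions with PROVED glue: L ↔ completeSector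
(`completeMustDrain_iff_completeSector'`), C1 ⇒ incompleteSector (`incompleteSector_of_hidden`), (★) ⇒ incompleteSector
(`incompleteSector_of_naked`). -/

/-- Statement of `stub_completeSector` (registered, lead c5): the COMPLETE SECTOR of the crux — every future causally
geodesically complete maximal vacuum Cauchy development of an admissible datum has vanishing final Bondi mass (the no-soliton
theorem at `𝓘⁺` for complete spacetimes; L with its idle complete-`𝓘⁺` hypothesis dropped). -/
def Sig.stub_completeSector : Prop :=
  open scoped Manifold in ∀ (X : Type) [TopologicalSpace X] [ChartedSpace Literature.Geometry.Lorentzian.E3 X] [IsManifold (𝓡 3) ((⊤ : ℕ∞) : WithTop ℕ∞) X] [T2Space X] [SecondCountableTopology X] [ConnectedSpace X], ∀ D ∈ Literature.Geometry.Lorentzian.admissibleVacuumData X, ∀ 𝒟 : Literature.Geometry.Lorentzian.VacuumCauchyDevelopment D, 𝒟.IsMaximal → (∀ [𝒟.metric.HasLeviCivita], ¬ 𝒟.metric.IsFutureNullGeodesicallyIncomplete 𝒟.timeOrientation ∧ ¬ 𝒟.metric.IsFutureTimelikeGeodesicallyIncomplete 𝒟.timeOrientation) → 𝒟.toCauchy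Development.HasVanishingFinalBondiMass

/-- Statement of `stub_incompleteSector` (registered, lead c5): the INCOMPLETE SECTOR of the crux — every maximal vacuum Cauchy
development of an admissible datum with complete `𝓘⁺` (sojourn form), no event horizon (typed clause, verbatim) and which is
NOT future causally geodesically complete has vanishing final Bondi mass (what statement C — censored + horizonless ⇒ future
causally complete — says is vacuous). -/
def Sig.stub_incompleteSector : Prop :=
  open scoped Manifold in ∀ (X : Type) [TopologicalSpace X] [ChartedSpace Literature.Geometry.Lorentzian.E3 X] [IsManifold (𝓡 3) ((⊤ : ℕ∞) : WithTop ℕ∞) X] [T2Space X] [SecondCountableTopology X] [ConnectedSpace X], ∀ D ∈ Literature.Geometry.Lorentzian.admissibleVacuumData X, ∀ 𝒟 : Literature.Geometry.Lorentzian.VacuumCauchyDevelopment D, 𝒟.IsMaximal → Summit.FinalStateConjecture.HasCompleteNullInfinity 𝒟.toCauchyDevelopment → ¬ (∀ [𝒟.metric.HasLeviCivita], ∃ q : 𝒟.carrier, ∀ (p : X) (γ : ℝ → 𝒟.carrier) (dom : Set ℝ), 𝒟.metric.IsNormalisedNullRayFrom 𝒟.timeOrientation 𝒟.embed 𝒟.normal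 p γ dom → ¬ BddAbove dom → q ∉ 𝒟.metric.chronologicalPast 𝒟.timeOrientation (γ '' (dom ∩ Set.Ici 0))) → ¬ (∀ [𝒟.metric.HasLeviCivita], ¬ 𝒟.metric.IsFutureNullGeodesicallyIncomplete 𝒟.timeOrientation ∧ ¬ 𝒟.metric.IsFutureTimelikeGeodesicallyIncomplete 𝒟.timeOrientation) → 𝒟.toCauchyDevelopment.HasVanishingFinalBondiMass

/-- Statement C of the line (censored + horizonless ⇒ future causally geodesically complete); since the reshape of lead c3
no longer a registered stub but the COMPOSITE of C1 `Sig.stub_incompletenessHidden_of_scriComplete` with the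
no-horizon hypothesis (`horizonlessComplete_of_hidden`); it empties the incomplete sector (`incompleteSector_of_C'`). -/
def Sig.horizonlessComplete : Prop :=
  open scoped Manifold in ∀ (X : Type) [TopologicalSpace X] [ChartedSpace Literature.Geometry.Lorentzian.E3 X] [IsManifold (𝓡 3) ((⊤ : ℕ∞) : WithTop ℕ∞) X] [T2Space X] [SecondCountableTopology X] [ConnectedSpace X], ∀ D ∈ Literature.Geometry.Lorentzian.admissibleVacuumData X, ∀ 𝒟 : Literature.Geometry.Lorentzian.VacuumCauchyDevelopment D, 𝒟.IsMaximal → Summit.FinalStateConjecture.HasCompleteNullInfinity 𝒟.toCauchyDevelopment → ¬ (∀ [𝒟.metric.HasLeviCivita], ∃ q : 𝒟.carrier, ∀ (p : X) (γ : ℝ → 𝒟.carrier) (dom : Set ℝ), 𝒟.metric.IsNormalisedNullRayFrom 𝒟.timeOrientation 𝒟.embed 𝒟.normal p γ dom → ¬ BddAbove dom → q ∉ 𝒟.metric.chronologicalPast 𝒟.timeOrientation (γ '' (dom ∩ Set.Ici 0))) → ∀ [𝒟.metric.HasLeviCivita], ¬ 𝒟.metric.IsFutureNullGeodesicallyIncomplete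 𝒟.timeOrientation ∧ ¬ 𝒟.metric.IsFutureTimelikeGeodesicallyIncomplete 𝒟.timeOrientation

/-- Statement L (registered stub of leads c0–c4, `stub_completeMustDrain`; since lead c5 a legend proposition only): censored +
future causally geodesically complete ⇒ vanishing final Bondi mass.  Equivalent to the complete sector
(`completeMustDrain_iff_completeSector'`). -/
def Sig.stub_completeMustDrain : Prop :=
  open scoped Manifold in ∀ (X : Type) [TopologicalSpace X] [ChartedSpace Literature.Geometry.Lorentzian.E3 X] [IsManifold (𝓡 3) ((⊤ : ℕ∞) : WithTop ℕ∞) X] [T2Space X] [SecondCountableTopology X] [ConnectedSpace X], ∀ D ∈ Literature.Geometry.Lorentzian.admissibleVacuumData X, ∀ 𝒟 : Literature.Geometry.Lorentzian.VacuumCauchyDevelopment D, 𝒟.IsMaximal → Summit.FinalStateConjecture.HasCompleteNullInfinity 𝒟.toCauchyDevelopment → (∀ [𝒟.metric.HasLeviCivita], ¬ 𝒟.metric.IsFutureNullGeodesicallyIncomplete 𝒟.timeOrientation ∧ ¬ 𝒟.metric.IsFutureTimelikeGeodesicallyIncomplete 𝒟.timeOrientation) → 𝒟.toCauchyDevelo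pment.HasVanishingFinalBondiMass

/-- Statement C1 (registered stub of leads c3–c4, `stub_incompletenessHidden_of_scriComplete`; since lead c5 a legend proposition
only, blocked on the unprinted fact (★), `C1-blocked.md`): in a censored MGHD (complete `𝓘⁺`, sojourn form) every
future-incomplete future-directed causal maximal geodesic has an event which is NOT visible from infinity (lies in the intrinsic
black-hole region) — "complete `𝓘⁺` ⇒ incompleteness is hidden", the sojourn form of future asymptotic predictability
(Hawking–Ellis 1973, §9.2, pp. 310–312; Christodoulou 1999, pp. A26–A27).  DUAL to route CurvatureOrSymmetry's support item
`VisibleIncompleteRay` (stmt-FinalStateConjecture-10213).  SUFFICIENT for the incomplete sector (`incompleteSector_of_hidden`),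
not necessary: it may fail in the "incompleteness at `i⁺`" scenario (a future-incomplete causal geodesic seen ever later along
complete rays, `recedingViewpoints`) while the crux survives. -/
def Sig.stub_incompletenessHidden_of_scriComplete : Prop :=
  open scoped Manifold in ∀ (X : Type) [TopologicalSpace X] [ChartedSpace Literature.Geometry.Lorentzian.E3 X] [IsManifold (𝓡 3) ((⊤ : ℕ∞) : WithTop ℕ∞) X] [T2Space X] [SecondCountableTopology X] [ConnectedSpace X], ∀ D ∈ Literature.Geometry.Lorentzian.admissibleVacuumData X, ∀ 𝒟 : Literature.Geometry.Lorentzian.VacuumCauchyDevelopment D, 𝒟.IsMaximal → Summit.FinalStateConjecture.HasCompleteNullInfinity 𝒟.toCauchyDevelopment → ∀ [𝒟.metric.HasLeviCivita], ∀ (γ : ℝ → 𝒟.carrier) (dom : Set ℝ), Literature.Geometry.Lorentzian.IsMaximalGeodesicOn 𝒟.metric.leviCivita γ dom → dom.Nonempty → BddAbove dom → (∀ t ∈ dom, 𝒟.metric.IsCausal (Literature.Geometry.Lorentzian.velocity (𝓡 4) γ t) ∧ 𝒟.timeOrientation.IsFutureDirected (Literature.Geometry.Lorentzian.velocity (𝓡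 4) γ t)) → ∃ t ∈ dom, ¬ 𝒟.toDataEmbedding.IsVisibleEvent (γ t)

/-! ## Registered stubs (`sorry` only here; signatures fully qualified and self-contained) -/

/-- **COMPLETE SECTOR — FUTURE-COMPLETE VACUUM MGHDs RADIATE AWAY ALL THEIR MASS** (registered stub, lead c5; the no-soliton
theorem at `𝓘⁺` in the currency of Anderson 2000, Thm 0.1; the load-bearing half of the crux).  For every admissible datum `D`
and every maximal vacuum Cauchy development `𝒟` of `D` which is future causally geodesically complete (no maximal future-directed
null or timelike geodesic with affine domain bounded above), the final Bondi mass vanishes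
(`CauchyDevelopment.HasVanishingFinalBondiMass`: for every `ε > 0` some compact `K ⊆ M` carries an asymptotically round receding
family of sections of `∂J⁺(K)` with Hawking masses eventually `≤ ε`).  NECESSARY for the crux (`completeSector_of_horizonlessMustDrain`,
LogicTier: on a future-complete MGHD complete `𝓘⁺` and the typed no-horizon clause hold automatically, W3/W6) and, with the
incomplete sector, SUFFICIENT (`horizonlessMustDrain_iff_sectors`).  Intended mechanism (route header, TWO-LAYER PLAN): Bondi mass
loss + positivity ⇒ quiet windows; quantitative unique continuation from `𝓘⁺` (arXiv:1312.1989, AlexakisSchlue2018) ⇒ approximate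
stationarity; completeness ⇒ late-time limits are complete stationary chronological vacuum spacetimes, flat by
`Anderson2000_completeStationaryVacuumFlat` (hypothesis form) ⇒ no parked mass.  In substance the Bondi-mass form of route
NoParkingWithoutHorizon's crux `CompleteSpacetimesDisperse` (bridge `completeSpacetimesDisperse_of_drainImpliesDisperse_of_completeSector`,
LogicTier).  Why it might fail: a future-complete eternal vacuum breather / geon with `M_B ↓ M_∞ > 0` (only stationary —
Lichnerowicz, Anderson2000 — and time-periodic / infinite-order non-radiating near `𝓘⁺` — BicakScholtzTod2010, AlexakisSchlue2018 —
solitons are excluded in print); quiet-window limits need bounded geometry that completeness alone may not supply.  Fibrewise it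
holds wherever `D` has ONE geodesically complete vacuum Cauchy development with vanishing final Bondi mass
(`stub_completeDevelopmentDecides`, LogicTier; the trivial fibre: `stub_trivialDatumFibre`).  Sources: Anderson2000 (Thm 0.1),
AlexakisSchlue2018 (Thm 1.1), BicakScholtzTod2010, arXiv:1312.1989, ChristodoulouKlainerman1993 (Ch. 17), Christodoulou1991,
SchoenYau1982, LudvigsenVickers1982.  Size: open-problem. -/
theorem stub_completeSector : open scoped Manifold in ∀ (X : Type) [TopologicalSpace X] [ChartedSpace Literature.Geometry.Lorentzian.E3 X] [IsManifold (𝓡 3) ((⊤ : ℕ∞) : WithTop ℕ∞) X] [T2Space X] [SecondCountableTopology X] [ConnectedSpace X], ∀ D ∈ Literature.Geometry.Lorentzian.admissibleVacuumData X, ∀ 𝒟 : Literature.Geometry.Lorentzian.VacuumCauchyDevelopment D, 𝒟.IsMaximal → (∀ [𝒟.metric.HasLeviCivita], ¬ 𝒟.metric.IsFutureNullGeodesicallyIncomplete 𝒟.timeOrientation ∧ ¬ 𝒟.metric.IsFutureTimelikeGeodesicallyIncomplete 𝒟.timeOrientation) → 𝒟.toCauchyDevelopment.HasVanishingFinalBondiMass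 := by
  sorry

/-- **INCOMPLETE SECTOR — CENSORED, HORIZONLESS, FUTURE-INCOMPLETE VACUUM MGHDs RADIATE AWAY ALL THEIR MASS** (registered stub,
lead c5; the other half of the crux).  For every admissible datum `D` and every maximal vacuum Cauchy development `𝒟` of `D` with
complete future null infinity (sojourn form) and no event horizon (typed clause of the crux, verbatim: every event lies in the
chronological past of the future half of some future-complete normalised null ray from the data hypersurface) which is NOT
future causally geodesically complete, the final Bondi mass vanishes.  NECESSARY for the crux (forget the incompleteness
hypothesis, `incompleteSector_of_horizonlessMustDrain`) and, with the complete sector, SUFFICIENT (`horizonlessMustDrain_iff_sectors`).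
Expected proof: the hypotheses are CONTRADICTORY — "weak cosmic censorship + no black hole ⇒ no singularity": an incomplete
future causal geodesic of an MGHD ends on the MGHD boundary; if all of its events are visible from complete rays the boundary is
visible from infinity and `𝓘⁺` is incomplete (statement C; sufficient forms C1 `incompleteSector_of_hidden` and (★)
`incompleteSector_of_naked`, the latter two reduced in the tree as far as `stub_noSingleViewpoint` / `stub_hiddenOfNaked`,
p161253 / p161294).  Why it might fail: only if BOTH (i) a censored horizonless vacuum MGHD with a future-incomplete causal
geodesic "at `i⁺`" exists (seen ever later along complete rays — not excluded in print) AND (ii) it parks mass; (i) alone kills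
C/C1/(★) but not this stub.  Fibrewise it holds (vacuously) wherever `D` has a geodesically complete vacuum Cauchy development
(every MGHD is then isometric to it, `CompleteDevelopmentMaximal`).  Sources: Penrose1965; HawkingEllis1973 §9.2 (future
asymptotic predictability, Prop. 9.2.1) and §8.2; Wald1984 §12.1; Christodoulou1999 (pp. A26–A27); DafermosLuk2017;
arXiv:0811.0354 §2.6.2.  Size: L/XL (unprinted for the sojourn form). -/
theorem stub_incompleteSector : open scoped Manifold in ∀ (X : Type) [TopologicalSpace X] [ChartedSpace Literature.Geometry.Lorentzian.E3 X] [IsManifold (𝓡 3) ((⊤ : ℕ∞) : WithTop ℕ∞) X] [T2Space X] [SecondCountableTopology X] [ConnectedSpace X], ∀ D ∈ Literature.Geometry.Lorentzian.admissibleVacuumData X, ∀ 𝒟 : Literature.Geometry.Lorentzian.VacuumCauchyDevelopment D, 𝒟.IsMaximal → Summit.FinalStateConjecture.HasCompleteNullInfinity 𝒟.toCauchyDevelopment → ¬ (∀ [𝒟.metric.HasLeviCivita], ∃ q : 𝒟.carrier, ∀ (p : X) (γ : ℝ → 𝒟.carrier) (dom : Set ℝ), 𝒟.metric.IsNormalisedNullRayFrom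 𝒟.timeOrientation 𝒟.embed 𝒟.normal p γ dom → ¬ BddAbove dom → q ∉ 𝒟.metric.chronologicalPast 𝒟.timeOrientation (γ '' (dom ∩ Set.Ici 0))) → ¬ (∀ [𝒟.metric.HasLeviCivita], ¬ 𝒟.metric.IsFutureNullGeodesicallyIncomplete 𝒟.timeOrientation ∧ ¬ 𝒟.metric.IsFutureTimelikeGeodesicallyIncomplete 𝒟.timeOrientation) → 𝒟.toCauchyDevelopment.HasVanishingFinalBondiMass := by
  sorry

/-! ## Composition: the crux BY NAME from the two registered stubs (real proof, no `sorry`) -/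

open Summit.FinalStateConjecture.FinalStateConjecture.Theorems.BondiDrainDispersalHorizonlessMustDrain
  (horizonlessMustDrain_iff_sectors completeSector_of_horizonlessMustDrain incompleteSector_of_horizonlessMustDrain
    incompleteSector_of_C)

/-- **HorizonlessMustDrain from its two sectors**: excluded middle on future causal geodesic completeness of the given MGHD
(`horizonlessMustDrain_iff_sectors`, LogicTier, p157550).  The hypotheses are the two registered stub statements (`Sig.*`,
verbatim); the conclusion is the route decl `Theses.BondiDrainDispersal.HorizonlessMustDrain` itself. -/
theorem HorizonlessMustDrain_of :
    Sig.stub_completeSector → Sig.stub_incompleteSector → HorizonlessMustDrain :=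
  fun hC hI ↦ horizonlessMustDrain_iff_sectors.2 ⟨hC, hI⟩

/-- The crux by name, closed modulo the two registered stubs (kernel check that the stub statements are
literally the hypotheses of `HorizonlessMustDrain_of`). -/
theorem horizonlessMustDrain_of_stubs : HorizonlessMustDrain :=
  HorizonlessMustDrain_of stub_completeSector stub_incompleteSector

/-- **Both registered stubs are NECESSARY**: the crux implies each sector (so the skeleton is an equivalence, and a refutation of
either stub refutes the crux). [folklore] -/
theorem sectors_of_horizonlessMustDrain (h : HorizonlessMustDrain) :
    Sig.stub_completeSector ∧ Sig.stub_incompleteSector :=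
  ⟨completeSector_of_horizonlessMustDrain h, incompleteSector_of_horizonlessMustDrain h⟩

/-- **The skeleton is an equivalence**: `HorizonlessMustDrain ↔ Sig.stub_completeSector ∧ Sig.stub_incompleteSector`. [folklore] -/
theorem horizonlessMustDrain_iff_stubs :
    HorizonlessMustDrain ↔ Sig.stub_completeSector ∧ Sig.stub_incompleteSector :=
  ⟨sectors_of_horizonlessMustDrain, fun h ↦ HorizonlessMustDrain_of h.1 h.2⟩

/-! ## Glue from the earlier stub statements (proved): C1 ⇒ C ⇒ incomplete sector -/

/-- **C from C1 (glue, proved): censored + horizonless ⇒ future causally geodesically complete.**  Under the no-horizon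
hypothesis every event is visible (`noHorizon_iff_forall_isVisibleEvent`), so by C1 no future-directed null or timelike maximal
geodesic can have affine domain bounded above. [folklore] -/
theorem horizonlessComplete_of_hidden (hC1 : Sig.stub_incompletenessHidden_of_scriComplete) : Sig.horizonlessComplete := by
  intro X _ _ _ _ _ _ D hD 𝒟 hmax hscri hH _
  have hvis : ∀ q, 𝒟.toDataEmbedding.IsVisibleEvent q :=
    (Summit.FinalStateConjecture.FinalStateConjecture.Theorems.BondiDrainDispersalHorizonlessMustDrain.noHorizon_iff_forall_isVisibleEvent 𝒟).1 hH
  constructor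
  · rintro ⟨γ, s, hγ, hne, hbdd, hvel⟩
    obtain ⟨t, -, hnot⟩ := hC1 X D hD 𝒟 hmax hscri γ s hγ hne hbdd fun t ht ↦
      ⟨(𝒟.metric.isCausal_iff_isTimelike_or_isNull _).2 (Or.inr (hvel t ht).1), (hvel t ht).2⟩
    exact hnot (hvis _)
  · rintro ⟨γ, s, hγ, hne, hbdd, hvel⟩
    obtain ⟨t, -, hnot⟩ := hC1 X D hD 𝒟 hmax hscri γ s hγ hne hbdd fun t ht ↦
      ⟨(𝒟.metric.isCausal_iff_isTimelike_or_isNull _).2 (Or.inl (hvel t ht).1), (hvel t ht).2⟩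
    exact hnot (hvis _)

/-- **C empties the incomplete sector** (kernel check of the landed `incompleteSector_of_C` against the legend). [folklore] -/
theorem incompleteSector_of_C' (hC : Sig.horizonlessComplete) : Sig.stub_incompleteSector :=
  incompleteSector_of_C hC

/-- **C1 ⇒ incomplete sector** (the registered stub of leads c3–c4 is a sufficient condition for the registered stub of lead
c5). [folklore] -/
theorem incompleteSector_of_hidden (hC1 : Sig.stub_incompletenessHidden_of_scriComplete) : Sig.stub_incompleteSector :=
  incompleteSector_of_C' (horizonlessComplete_of_hidden hC1)

/-- **The old composition survives as a corollary**: C1 and L give the crux (C1 ⇒ incomplete sector; L ⇒ complete sector by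
forgetting L's complete-`𝓘⁺` hypothesis, supplied by W6). [folklore] -/
theorem HorizonlessMustDrain_of_hidden_of_completeMustDrain :
    Sig.stub_incompletenessHidden_of_scriComplete → Sig.stub_completeMustDrain → HorizonlessMustDrain :=
  fun hC1 hL ↦ HorizonlessMustDrain_of
    (Summit.FinalStateConjecture.FinalStateConjecture.Theorems.BondiDrainDispersalHorizonlessMustDrain.completeMustDrain_iff_completeSector.1 hL)
    (incompleteSector_of_hidden hC1)

/-! ## Sanity tier (lead c2, 2026-08-17): the trivial-datum fibre — the first round receding family of the tree

The ∀-data tier above (C, L) is the open problem.  The crux's CONCLUSION, `HasVanishingFinalBondiMass`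
(definition N1, `CutBondiMass.lean`), had never been inhabited in the tree ("Sanity (not formalised)" in its module
docstring; the only result about `RoundSectionFamily` so far is an EMPTINESS theorem, KissingBallsCutMass.lean).  The
stubs below cut the sanity certificate — the round sections `S_r = {t = r, |x| = r}` of the light cone `∂J⁺({0})` of
Minkowski spacetime form a round receding family of Hawking mass `0`, so Minkowski space, and with it EVERY maximal
vacuum Cauchy development of the trivial datum `(ℝ³, δ, 0)`, has vanishing final Bondi mass — into five independent
computations (cone placement and generators; embedding, spacelikeness and the null normal pair; area `4πr²`; Gauss
curvature `1/r²`; null expansions `±2/r`) and one transport lemma (invariance of `HasVanishingFinalBondiMass` under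
isometry of developments).  The assembly (`minkowski_hasCutBondiMass_origin_zero`, `minkowski_hasVanishingFinalBondiMass`,
`horizonlessMustDrain_trivialDatumFibre`) is proved here from the stubs, sorry-free, so that every stub signature is
checked against its use.  No new definition is introduced: the sections are the literal maps
`fun y ↦ E4.ofTimeSpace r (r • y)` on Mathlib's unit sphere `Metric.sphere (0 : E3) 1`.
-/

section SanityTier

open Metric MeasureTheory

/-! ### S1–S6: LANDED (wave 1, 2026-08-17) — imported from the tree, no longer skeleton obligations

* S1 `stub_minkowskiConeSection` — p149417, `Theorems/BondiDrainDispersalHorizonlessMustDrainMinkowskiConeSection.lean`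
* S2 `stub_minkowskiSphereSection` — p149853, `Theorems/BondiDrainDispersalHorizonlessMustDrainMinkowskiSphereSection.lean`
* S3 `stub_minkowskiSectionArea` — p149938, `Theorems/BondiDrainDispersalHorizonlessMustDrainMinkowskiSectionArea.lean`
* S4 `stub_minkowskiSectionGauss` — p150364, `Theorems/BondiDrainDispersalHorizonlessMustDrainMinkowskiSectionGauss.lean`
* S5 `stub_minkowskiSectionNullExpansion` — p150198, `Theorems/BondiDrainDispersalHorizonlessMustDrainMinkowskiSectionNullExpansion.lean`
* S6 `stub_hasVanishingFinalBondiMass_transport` — p149707, `Theorems/BondiDrainDispersalHorizonlessMustDrainHasVanishingFinalBondiMassTransport.lean`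

(all in namespace `Summit.FinalStateConjecture.FinalStateConjecture.Theorems.BondiDrainDispersalHorizonlessMustDrain`, opened below). -/

open Summit.FinalStateConjecture.FinalStateConjecture.Theorems.BondiDrainDispersalHorizonlessMustDrain
  (stub_minkowskiConeSection stub_minkowskiSphereSection stub_minkowskiSectionArea stub_minkowskiSectionGauss
    stub_minkowskiSectionNullExpansion stub_hasVanishingFinalBondiMass_transport)

/-! ### Assembly of the sanity tier (sorry-free; S1–S6 landed) — registered as the glue stubs `stub_minkowskiVanishingFinalBondiMass`, `stub_trivialDatumFibre` -/

open Literature.Geometry.Lorentzian.Minkowski in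
/-- **The cut of `𝓘⁺` by the light cone of the origin of Minkowski spacetime has Bondi mass `0`**: the round sections
`S_{ρ(s)} = {t = ρ(s), |x| = ρ(s)}`, `ρ(s) = max s 1`, of `∂J⁺({0})` form a round receding family
(`CauchyDevelopment.RoundSectionFamily`) — on the cone with the generators `t ↦ (ρ + t, (ρ + t) y)` tangent to
`L = (1, y)` (S1, S2), areas `4πρ² → ∞` (S3), `K · |S| / 4π = ρ⁻² · 4πρ² / 4π = 1` identically (S3, S4) — all of whose
Hawking masses vanish: `∫ θ_L θ_L̲ dA = (2/ρ)(-2/ρ) · 4πρ² = -16π` (S3, S5, `hawkingMass_eq_zero_of_integral_eq`).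
This is the "Sanity (not formalised)" remark of `CutBondiMass.lean`, formalised modulo the registered stubs.
Christodoulou–Klainerman 1993, Ch. 17 (`M ≡ 0` for Minkowski space); Hawking 1968, §3. -/
theorem minkowski_hasCutBondiMass_origin_zero :
    vacuumCauchyDevelopment.toCauchyDevelopment.HasCutBondiMass {(0 : E4)} 0 := by
  classical
  -- radii `ρ s = max s 1 > 0`, `ρ s → ∞`
  set ρ : ℝ → ℝ := fun s ↦ max s 1 with hρ_def
  have hρ : ∀ s, 0 < ρ s := fun s ↦ lt_of_lt_of_le one_pos (le_max_right _ _)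
  have hρtop : Tendsto ρ atTop atTop := tendsto_atTop_mono (fun s ↦ le_max_left s 1) tendsto_id
  -- S2: embedding, spacelikeness, null normal pair (chosen)
  have hS2 := fun s ↦ stub_minkowskiSphereSection (ρ s) (hρ s)
  let P : ∀ s : ℝ, LorentzianMetric.NullNormalPair (𝓡 2) vacuumCauchyDevelopment.toCauchyDevelopment.metric
      vacuumCauchyDevelopment.toCauchyDevelopment.timeOrientation
      (fun y : sphere (0 : E3) 1 ↦ E4.ofTimeSpace (ρ s) (ρ s • (y : E3))) :=
    fun s ↦ Classical.choose (hS2 s).2.2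
  have hP : ∀ s, (∀ y, (P s).L y = E4.ofTimeSpace 1 (y : E3)) ∧
      (∀ y, (P s).Lbar y = E4.ofTimeSpace 1 (-(y : E3))) :=
    fun s ↦ Classical.choose_spec (hS2 s).2.2
  -- S3: the areas
  have hA : ∀ s, vacuumCauchyDevelopment.toCauchyDevelopment.metric.surfaceArea
      (fun y : sphere (0 : E3) 1 ↦ E4.ofTimeSpace (ρ s) (ρ s • (y : E3))) (hS2 s).2.1 =
        ENNReal.ofReal (4 * Real.pi * ρ s ^ 2) :=
    fun s ↦ stub_minkowskiSectionArea (ρ s) (hρ s) (hS2 s).2.1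
  have hA' : ∀ s, (vacuumCauchyDevelopment.toCauchyDevelopment.metric.surfaceArea
      (fun y : sphere (0 : E3) 1 ↦ E4.ofTimeSpace (ρ s) (ρ s • (y : E3))) (hS2 s).2.1).toReal =
        4 * Real.pi * ρ s ^ 2 :=
    fun s ↦ by rw [hA s, ENNReal.toReal_ofReal (by positivity)]
  -- the family
  let 𝓕 : CauchyDevelopment.RoundSectionFamily vacuumCauchyDevelopment.toCauchyDevelopment {(0 : E4)} :=
    { sec := fun s y ↦ E4.ofTimeSpace (ρ s) (ρ s • (y : E3))
      range_sec_subset := fun s ↦ by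
        rintro _ ⟨y, rfl⟩
        exact (stub_minkowskiConeSection (ρ s) (hρ s) y).1
      isSmoothEmbedding := fun s ↦ (hS2 s).1
      isSpacelike := fun s ↦ (hS2 s).2.1
      pair := P
      tangent_L := fun s y ↦ by
        refine ⟨fun t : ℝ ↦ E4.ofTimeSpace (ρ s + t) ((ρ s + t) • (y : E3)), ρ s, hρ s,
          (stub_minkowskiConeSection (ρ s) (hρ s) y).2.1, by simp, ?_, fun t ht ↦ ?_⟩
        · rw [(hP s).1 y]
          exact (stub_minkowskiConeSection (ρ s) (hρ s) y).2.2
        · exact (stub_minkowskiConeSection (ρ s + t) (by linarith [hρ s, ht.1]) y).1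
      tendsto_area := by
        have h : (fun s ↦ vacuumCauchyDevelopment.toCauchyDevelopment.metric.surfaceArea
            (fun y : sphere (0 : E3) 1 ↦ E4.ofTimeSpace (ρ s) (ρ s • (y : E3))) (hS2 s).2.1) =
            fun s ↦ ENNReal.ofReal (4 * Real.pi * ρ s ^ 2) := funext hA
        rw [h]
        refine ENNReal.tendsto_ofReal_atTop.comp ?_
        refine Tendsto.const_mul_atTop (by positivity) ?_
        exact (tendsto_pow_atTop two_ne_zero).comp hρtop
      round := by
        refine Metric.tendstoUniformly_iff.2 fun ε hε ↦ Filter.Eventually.of_forall fun s y ↦ ?_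
        rw [stub_minkowskiSectionGauss (ρ s) (hρ s) (hS2 s).2.1 y, hA' s]
        have : 1 / ρ s ^ 2 * (4 * Real.pi * ρ s ^ 2) / (4 * Real.pi) = 1 := by
          field_simp [(hρ s).ne']
        rw [this, dist_self]
        exact hε }
  refine ⟨𝓕, 𝓕.hasMassLimit_zero_of_eventually_eq (Filter.Eventually.of_forall fun s ↦ ?_)⟩
  -- every Hawking mass vanishes: `∫ θ_L θ_L̲ dA = -(4/ρ²) · 4πρ² = -16π`
  haveI := vacuumCauchyDevelopment.toCauchyDevelopment.metric.toPseudoRiemannianMetric.hasLeviCivita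
  unfold CauchyDevelopment.RoundSectionFamily.hawkingMass
  refine LorentzianMetric.hawkingMass_eq_zero_of_integral_eq _ _
    PseudoRiemannianMetric.contMDiff_pullbackBilin_holds ((hS2 s).2.1) (P s) ?_
  have hθ := stub_minkowskiSectionNullExpansion (ρ s) (hρ s) (hS2 s).2.1 (P s) (hP s).1 (hP s).2
  have hconst : (fun y : sphere (0 : E3) 1 ↦
      vacuumCauchyDevelopment.toCauchyDevelopment.metric.nullExpansion
          (fun y : sphere (0 : E3) 1 ↦ E4.ofTimeSpace (ρ s) (ρ s • (y : E3)))
          PseudoRiemannianMetric.contMDiff_pullbackBilin_holds (hS2 s).2.1 (P s).L y *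
        vacuumCauchyDevelopment.toCauchyDevelopment.metric.nullExpansion
          (fun y : sphere (0 : E3) 1 ↦ E4.ofTimeSpace (ρ s) (ρ s • (y : E3)))
          PseudoRiemannianMetric.contMDiff_pullbackBilin_holds (hS2 s).2.1 (P s).Lbar y) =
      fun _ ↦ -(4 / ρ s ^ 2) := by
    funext y
    rw [(hθ y).1, (hθ y).2]
    field_simp
    ring
  rw [hconst, MeasureTheory.integral_const, smul_eq_mul]
  -- the total mass of the area measure is the area `4πρ²`
  have hμ : ((riemannianVolume (vacuumCauchyDevelopment.toCauchyDevelopment.metric.inducedRiemannianMetric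
      (fun y : sphere (0 : E3) 1 ↦ E4.ofTimeSpace (ρ s) (ρ s • (y : E3)))
      PseudoRiemannianMetric.contMDiff_pullbackBilin_holds (hS2 s).2.1) 2) Set.univ).toReal =
        4 * Real.pi * ρ s ^ 2 := hA' s
  rw [Measure.real, hμ]
  field_simp [(hρ s).ne']
  ring

open Literature.Geometry.Lorentzian.Minkowski in
/-- **Minkowski spacetime, as the vacuum Cauchy development of `(ℝ³, δ, 0)`, has vanishing final Bondi mass**
(`CauchyDevelopment.HasVanishingFinalBondiMass`; from the cut of Bondi mass `0` on the compact set `{0}`,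
`HasCutBondiMass.hasVanishingFinalBondiMass`).  The first inhabitant of definition N1 in the tree (modulo the registered
stubs S1–S5).  Christodoulou–Klainerman 1993, Ch. 17. -/
theorem stub_minkowskiVanishingFinalBondiMass :
    Literature.Geometry.Lorentzian.Minkowski.vacuumCauchyDevelopment.toCauchyDevelopment.HasVanishingFinalBondiMass :=
  minkowski_hasCutBondiMass_origin_zero.hasVanishingFinalBondiMass isCompact_singleton

/-- **`HorizonlessMustDrain` HOLDS ON THE FIBRE OVER THE TRIVIAL DATUM** (`X = ℝ³ = Minkowski.slice`, `D = trivialData`,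
EVERY maximal vacuum Cauchy development; unconditionally, its hypotheses complete `𝓘⁺` and no horizon idle): a maximal
development of the trivial datum is isometric, as a development, to Minkowski space
(`Minkowski.isIsometricTo_vacuumCauchyDevelopment_of_isMaximal`, geodesic completeness ⇒ onto), which has vanishing final
Bondi mass (`stub_minkowskiVanishingFinalBondiMass`), a property invariant under isometry of developments (S6).  So the
crux's conclusion is satisfiable in its exact typing and a counterexample to the crux needs a NON-FLAT admissible datum —
the analogue for this crux of `Theorems/DrainImpliesDisperse/Negative/TrivialDatumFibre.lean`. -/
theorem stub_trivialDatumFibre :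
    ∀ 𝒟 : Literature.Geometry.Lorentzian.VacuumCauchyDevelopment Literature.Geometry.Lorentzian.trivialData, 𝒟.IsMaximal →
      Summit.FinalStateConjecture.HasCompleteNullInfinity 𝒟.toCauchyDevelopment →
      ¬ (∀ [𝒟.metric.HasLeviCivita], ∃ q : 𝒟.carrier, ∀ (p : Literature.Geometry.Lorentzian.Minkowski.slice) (γ : ℝ → 𝒟.carrier) (dom : Set ℝ),
          𝒟.metric.IsNormalisedNullRayFrom 𝒟.timeOrientation 𝒟.embed 𝒟.normal p γ dom → ¬ BddAbove dom →
            q ∉ 𝒟.metric.chronologicalPast 𝒟.timeOrientation (γ '' (dom ∩ Set.Ici 0))) →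
      𝒟.toCauchyDevelopment.HasVanishingFinalBondiMass :=
  fun _ hmax _ _ ↦
    stub_hasVanishingFinalBondiMass_transport _ _ (Minkowski.isIsometricTo_vacuumCauchyDevelopment_of_isMaximal hmax)
      stub_minkowskiVanishingFinalBondiMass

/-- **Typing link**: the crux, specialised to the trivial datum, is exactly the fibre statement above (so the fibre
theorem is the crux's own prediction there, kernel-checked against the route decl by name). [folklore] -/
theorem horizonlessMustDrain_specialises (h : HorizonlessMustDrain) :
    ∀ 𝒟 : VacuumCauchyDevelopment trivialData, 𝒟.IsMaximal →
      Summit.FinalStateConjecture.HasCompleteNullInfinity 𝒟.toCauchyDevelopment →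
      ¬ (∀ [𝒟.metric.HasLeviCivita], ∃ q : 𝒟.carrier, ∀ (p : Minkowski.slice) (γ : ℝ → 𝒟.carrier) (dom : Set ℝ),
          𝒟.metric.IsNormalisedNullRayFrom 𝒟.timeOrientation 𝒟.embed 𝒟.normal p γ dom → ¬ BddAbove dom →
            q ∉ 𝒟.metric.chronologicalPast 𝒟.timeOrientation (γ '' (dom ∩ Set.Ici 0))) →
      𝒟.toCauchyDevelopment.HasVanishingFinalBondiMass :=
  fun 𝒟 hmax hscri hH ↦ h Minkowski.slice trivialData trivialData_mem_admissibleVacuumData 𝒟 hmax hscri hH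


/-! ### Wave 2 (lead c2, LANDED): the hypotheses of the crux on the trivial fibre — no event horizon in Minkowski space, and
transport of the no-horizon clause along isometries of developments (complete `𝓘⁺` and its transport are in the tree:
`Minkowski.hasCompleteFutureNullInfinity_vacuumCauchyDevelopment`, `…WeakCosmicCensorshipMGHD.hasCompleteNullInfinity_iff_of_isIsometricTo`). -/

/-! W2a `stub_minkowskiNoHorizon` — LANDED p152194 (`Theorems/BondiDrainDispersalHorizonlessMustDrainMinkowskiNoHorizon.lean`);
W2b `stub_noHorizon_transport` — LANDED p152109 (`Theorems/BondiDrainDispersalHorizonlessMustDrainNoHorizonTransport.lean`); both imported. -/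

open Summit.FinalStateConjecture.FinalStateConjecture.Theorems.BondiDrainDispersalHorizonlessMustDrain
  (stub_minkowskiNoHorizon stub_noHorizon_transport)

open Literature.Geometry.Lorentzian.Minkowski in
/-- **THE CRUX HOLDS, HYPOTHESES INCLUDED, ON THE WHOLE FIBRE OVER THE TRIVIAL DATUM** (glue stub, proved from W2a, W2b, S6 and
the tree): every maximal vacuum Cauchy development `𝒟` of `(ℝ³, δ, 0)` HAS complete future null infinity (sojourn form), HAS no
event horizon in the ray-theoretic sense, AND has vanishing final Bondi mass — so on this fibre `HorizonlessMustDrain` is true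
with none of its hypotheses idle: the crux is consistent and non-vacuous in its exact typing, and any counterexample needs a
non-flat admissible datum.  Transport along `Minkowski.isIsometricTo_vacuumCauchyDevelopment_of_isMaximal` of
`hasCompleteFutureNullInfinity_vacuumCauchyDevelopment` (`hasCompleteNullInfinity_iff_of_isIsometricTo`), of W2a (by W2b) and of
`stub_minkowskiVanishingFinalBondiMass` (by S6). -/
theorem stub_trivialDatumFibreFull :
    ∀ 𝒟 : Literature.Geometry.Lorentzian.VacuumCauchyDevelopment Literature.Geometry.Lorentzian.trivialData, 𝒟.IsMaximal →
      Summit.FinalStateConjecture.HasCompleteNullInfinity 𝒟.toCauchyDevelopment ∧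
      ¬ (∀ [𝒟.metric.HasLeviCivita], ∃ q : 𝒟.carrier, ∀ (p : Literature.Geometry.Lorentzian.Minkowski.slice) (γ : ℝ → 𝒟.carrier) (dom : Set ℝ),
          𝒟.metric.IsNormalisedNullRayFrom 𝒟.timeOrientation 𝒟.embed 𝒟.normal p γ dom → ¬ BddAbove dom →
            q ∉ 𝒟.metric.chronologicalPast 𝒟.timeOrientation (γ '' (dom ∩ Set.Ici 0))) ∧
      𝒟.toCauchyDevelopment.HasVanishingFinalBondiMass := by
  intro 𝒟 hmax
  have hiso := Minkowski.isIsometricTo_vacuumCauchyDevelopment_of_isMaximal hmax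
  refine ⟨?_, ?_, stub_trivialDatumFibre 𝒟 hmax ?_ ?_⟩
  · exact (Summit.FinalStateConjecture.FinalStateConjecture.Theorems.PhaseMixingCapture.WeakCosmicCensorshipMGHD.hasCompleteNullInfinity_iff_of_isIsometricTo
      _ _ hiso).1 (fun {_} ↦ hasCompleteFutureNullInfinity_vacuumCauchyDevelopment)
  · exact stub_noHorizon_transport _ _ hiso stub_minkowskiNoHorizon
  · exact (Summit.FinalStateConjecture.FinalStateConjecture.Theorems.PhaseMixingCapture.WeakCosmicCensorshipMGHD.hasCompleteNullInfinity_iff_of_isIsometricTo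
      _ _ hiso).1 (fun {_} ↦ hasCompleteFutureNullInfinity_vacuumCauchyDevelopment)
  · exact stub_noHorizon_transport _ _ hiso stub_minkowskiNoHorizon

end SanityTier

/-! ## Logic tier (lead c3, 2026-08-17): LANDED — future causal completeness makes BOTH crux hypotheses automatic; `crux ⇒ L`

* W3 `stub_noHorizon_of_futureNullComplete` — p156437, `Theorems/BondiDrainDispersalHorizonlessMustDrainNoHorizonOfFutureNullComplete.lean`
  (in every Cauchy development, future null geodesic completeness ⇒ the typed no-horizon clause);
* W6 `stub_scriComplete_of_futureNullComplete` — p156711, `Theorems/BondiDrainDispersalHorizonlessMustDrainScriCompleteOfFutureNullComplete.lean`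
  (… ⇒ complete `𝓘⁺`, sojourn form);
* glue stubs `stub_cruxImpliesCompleteMustDrain` (crux ⇒ L), `stub_completeDevelopmentDecides` (W1) and the corollaries
  `horizonlessMustDrain_iff_sectors` (crux ↔ complete sector ∧ incomplete sector, pure logic), `horizonlessMustDrain_iff_completeSector_of_C`,
  `completeMustDrain_iff_completeSector` (L ↔ complete sector), `cruxInstance_of_completeDevelopment`,
  `completeSpacetimesDisperse_of_drainImpliesDisperse_of_completeSector` (bridge to NoParkingWithoutHorizon's crux) — p157550,
  `Theorems/BondiDrainDispersalHorizonlessMustDrainLogicTier.lean`.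

So the line reads: crux ↔ (complete sector = L) ∧ (incomplete sector ⇐ C ⇐ C1) — since lead c5 literally the registered skeleton.  The kernel
checks below pin the landed glue stubs against the legend `Sig.*`. -/

section LogicTier

open Summit.FinalStateConjecture.FinalStateConjecture.Theorems.BondiDrainDispersalHorizonlessMustDrain
  (stub_cruxImpliesCompleteMustDrain completeMustDrain_iff_completeSector horizonlessMustDrain_iff_completeSector_of_C)

/-- **L is a corollary of the crux** (kernel check of the landed glue stub against `Sig.stub_completeMustDrain`). -/
theorem completeMustDrain_of_horizonlessMustDrain (h : HorizonlessMustDrain) : Sig.stub_completeMustDrain :=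
  stub_cruxImpliesCompleteMustDrain h

/-- **L is the complete sector** (its complete-`𝓘⁺` hypothesis is idle): the registered stub of leads c0–c4 and the registered
stub of lead c5 are equivalent. -/
theorem completeMustDrain_iff_completeSector' : Sig.stub_completeMustDrain ↔ Sig.stub_completeSector :=
  completeMustDrain_iff_completeSector

/-- **Under C (hence under C1) the crux IS its complete sector.** -/
theorem horizonlessMustDrain_iff_completeSector_of_hidden (hC1 : Sig.stub_incompletenessHidden_of_scriComplete) :
    HorizonlessMustDrain ↔ Sig.stub_completeSector :=
  horizonlessMustDrain_iff_completeSector_of_C (horizonlessComplete_of_hidden hC1)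

end LogicTier

/-! ## Censorship tier (lead c4, 2026-08-17): how far the tree's causality reduces C1

Wave 1 of lead c4 (one stub-worker on C1, verdict `stub-blocked: none`, report `C1-blocked.md` attached to the crux item)
found two things the tree CAN certify about C1, registered here as glue stubs so that they land `--supports`:

* `stub_noSingleViewpoint` — **no event of a Cauchy development has a final segment of a maximal future-directed causal
  geodesic in its causal past** (compact causal diamonds `CauchyDevelopment.isCompact_causalDiamond` + non-imprisonment
  `IsStronglyCausal.exists_forall_notMem` + endlessness of maximal geodesics): a counterexample to C1 — a totally visible
  future-incomplete causal geodesic of a censored MGHD — is therefore never seen from ONE event; its viewpoints recede along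
  the complete rays ("incompleteness at the ideal endpoint of a complete ray" is the only shape left).
* `stub_hiddenOfNaked` — **(★) ⇒ C1**, where (★) `Sig.visibleIncompleteIsNaked` says: in an MGHD of an admissible datum, a
  future-incomplete future-directed causal maximal geodesic ALL of whose events are visible (complete-ray sense,
  `DataEmbedding.IsVisibleEvent`) is visible from infinity in the sojourn sense (`LorentzianMetric.IsVisibleFromInfinity`,
  IdealPoints.lean: seen by far, INCOMPLETE, bounded-sojourn rays).  Over the tree (★) closes C1 in six lines through the
  proved `IsVisibleFromInfinity.not_hasCompleteFutureNullInfinity`; (★) is the sharpest sufficient unprinted fact — "visible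
  incompleteness is naked", the sojourn-form reading of Hawking–Ellis §9.2 asymptotic predictability and the companion of
  route CurvatureOrSymmetry's support item `VisibleIncompleteRay` (stmt-FinalStateConjecture-10213, the converse reading:
  incomplete `𝓘⁺` ⇒ a visible incomplete null ray).  C1 itself stays registered (it is the exact contrapositive dual of
  10213); since lead c5 it is a legend proposition, sufficient for the registered `stub_incompleteSector`; (★) is recorded in `## Census`
  as `What is missing`. -/

section CensorshipTier

/-- (★) **A totally visible incomplete causal geodesic of an MGHD is naked** (sojourn sense) — the unprinted fact that
would close C1 (`hidden_of_naked`); stated WITHOUT the complete-`𝓘⁺` hypothesis (with it, it is C1). -/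
def Sig.visibleIncompleteIsNaked : Prop :=
  open scoped Manifold in ∀ (X : Type) [TopologicalSpace X] [ChartedSpace Literature.Geometry.Lorentzian.E3 X] [IsManifold (𝓡 3) ((⊤ : ℕ∞) : WithTop ℕ∞) X] [T2Space X] [SecondCountableTopology X] [ConnectedSpace X], ∀ D ∈ Literature.Geometry.Lorentzian.admissibleVacuumData X, ∀ 𝒟 : Literature.Geometry.Lorentzian.VacuumCauchyDevelopment D, 𝒟.IsMaximal → ∀ [𝒟.metric.HasLeviCivita], ∀ (γ : ℝ → 𝒟.carrier) (dom : Set ℝ), Literature.Geometry.Lorentzian.IsMaximalGeodesicOn 𝒟.metric.leviCivita γ dom → dom.Nonempty → BddAbove dom → (∀ t ∈ dom, 𝒟.metric.IsCausal (Literature.Geometry.Lorentzian.velocity (𝓡 4) γ t) ∧ 𝒟.timeOrientation.IsFutureDirected (Literature.Geometry.Lorentzian.velocity (𝓡 4) γ t)) → (∀ t ∈ dom, 𝒟.toDataEmbedding.IsVisibleEvent (γ t)) → 𝒟.metric.IsVisibleFromInfinity 𝒟.timeOrientation 𝒟.embed 𝒟.normal (γ '' dom)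

/-! ### NSV, HON: LANDED (wave 1 of lead c4, 2026-08-17) — imported from the tree, no longer skeleton obligations

* NSV `stub_noSingleViewpoint` — p161253, `Theorems/BondiDrainDispersalHorizonlessMustDrainNoSingleViewpoint.lean`
  (with the any-dimension lemmas `exists_notMem_causalPast_of_isMaximalGeodesicOn`, `exists_notMem_chronologicalPast_of_isMaximalGeodesicOn`);
* HON `stub_hiddenOfNaked` — p161294, `Theorems/BondiDrainDispersalHorizonlessMustDrainHiddenOfNaked.lean` ((★) ⇒ C1). -/

open Summit.FinalStateConjecture.FinalStateConjecture.Theorems.BondiDrainDispersalHorizonlessMustDrain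
  (stub_noSingleViewpoint stub_hiddenOfNaked)

/-- **(★) closes C1** (kernel check of the glue stub against the legend: hypothesis `Sig.visibleIncompleteIsNaked`, conclusion
`Sig.stub_incompletenessHidden_of_scriComplete`, both by `Iff.rfl`-free definitional unfolding). [folklore] -/
theorem hidden_of_naked (h : Sig.visibleIncompleteIsNaked) : Sig.stub_incompletenessHidden_of_scriComplete :=
  stub_hiddenOfNaked h

/-- **(★) ⇒ incomplete sector** ((★) ⇒ C1 ⇒ C ⇒ the incomplete sector is vacuous). [folklore] -/
theorem incompleteSector_of_naked (h : Sig.visibleIncompleteIsNaked) : Sig.stub_incompleteSector :=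
  incompleteSector_of_hidden (hidden_of_naked h)

/-- **The crux from (★) and the complete sector**: "visible incompleteness is naked" and "future-complete vacuum MGHDs drain"
give `HorizonlessMustDrain` by name. [folklore] -/
theorem HorizonlessMustDrain_of_naked :
    Sig.visibleIncompleteIsNaked → Sig.stub_completeSector → HorizonlessMustDrain :=
  fun h hC ↦ HorizonlessMustDrain_of hC (incompleteSector_of_naked h)

/-- **Receding viewpoints** (what NSV says about a would-be counterexample to C1): if every event of a future-incomplete
future-directed causal maximal geodesic `γ` of a Cauchy development is visible, then NO single event `x` — in particular no
point `δ σ` of a complete normalised null ray — has a final segment of `γ` in its chronological past: beyond every `t₀` some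
`γ t ∉ I⁻(x)`.  So the witnessing parameters along each complete ray are unbounded ("incompleteness seen ever later", the
shape at the ideal endpoint of a complete ray). [folklore] -/
theorem recedingViewpoints {X : Type} [TopologicalSpace X] [ChartedSpace E3 X] [IsManifold (𝓡 3) ∞ X] [ConnectedSpace X]
    {D : InitialDataSet (𝓡 3) X} (𝒟 : CauchyDevelopment D) [𝒟.metric.HasLeviCivita] {γ : ℝ → 𝒟.carrier} {dom : Set ℝ}
    (hγ : IsMaximalGeodesicOn 𝒟.metric.leviCivita γ dom)
    (hvel : ∀ t ∈ dom, 𝒟.metric.IsCausal (velocity (𝓡 4) γ t) ∧ 𝒟.timeOrientation.IsFutureDirected (velocity (𝓡 4) γ t))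
    (x : 𝒟.carrier) {t₀ : ℝ} (ht₀ : t₀ ∈ dom) :
    ∃ t ∈ dom, t₀ ≤ t ∧ γ t ∉ 𝒟.metric.chronologicalPast 𝒟.timeOrientation {x} := by
  obtain ⟨t, ht, h0, hJ⟩ := stub_noSingleViewpoint X D 𝒟 γ dom hγ hvel x t₀ ht₀
  exact ⟨t, ht, h0, fun hI ↦
    hJ (LorentzianMetric.chronologicalFuture_subset_causalFuture 𝒟.metric 𝒟.timeOrientation.reverse {x} hI)⟩

end CensorshipTier

/-! ## Sector tier (lead c5, 2026-08-17): LANDED — the incomplete sector fibrewise; the two Bondi cruxes predict Penrose's theorem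

Wave 1 of lead c5 (one stub-worker on the registered `stub_incompleteSector`, verdict `stub-blocked: none (unprinted (★))` — the
extra hypotheses of the sector over C1, total visibility and maximality, give no in-tree contradiction: a fixed incomplete geodesic
never starts outside the `B₁(s)` of the sojourn clause, and total visibility supplies only COMPLETE far rays, never the incomplete
bounded-sojourn rays `IsVisibleFromInfinity` needs) landed the provable FIBREWISE form, and the lead landed the cross-route link:

* FIB `stub_incompleteSectorFibre` — p164607, `Theorems/BondiDrainDispersalHorizonlessMustDrainIncompleteSectorFibre.lean`: if the
  datum has ONE geodesically complete vacuum Cauchy development, every MGHD of it is future causally geodesically complete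
  (`futureCausallyComplete_of_isMaximal_of_completeDevelopment`: maximality embeds the complete development, completeness makes the
  embedding onto, geodesic completeness moves along the isometry), so the incomplete sector holds there vacuously; with
  `not_isFutureTimelikeGeodesicallyIncomplete_of_isGeodesicallyComplete` (timelike twin of LogicTier's null lemma).
* TRP `stub_trappedHasHorizon_of_cruxes` — p164880, `Theorems/BondiDrainDispersalHorizonlessMustDrainTrappedHorizon.lean`:
  `HorizonlessMustDrain ∧ NoNullFinalMomentum.TrappedImpliesMassive` (stmt-FinalStateConjecture-11720, verbatim) ⇒ every censored
  MGHD of an admissible datum with a closed trapped surface in `J⁺(ι X)` HAS an event horizon (nonempty black-hole region) — the two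
  Bondi cruxes of the summit jointly predict Hawking–Ellis Prop. 9.2.1 in the summit's typing (mutual consistency), and a censored
  horizonless MGHD with a trapped surface would refute their conjunction (`not_both_cruxes_of_trappedHorizonless`). -/

section SectorTier

open Summit.FinalStateConjecture.FinalStateConjecture.Theorems.BondiDrainDispersalHorizonlessMustDrain
  (stub_incompleteSectorFibre stub_trappedHasHorizon_of_cruxes)

/-- **On the complete-development locus the crux IS its complete sector, with no censorship input**: if `Sig.stub_completeSector`
holds, then at every admissible datum `D` possessing a geodesically complete vacuum Cauchy development the crux instance holds at
EVERY maximal vacuum Cauchy development of `D` — the incomplete sector being vacuous there (FIB).  (On this locus the crux thus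
reduces to ONE number per datum, the final Bondi mass of the complete development, cf. `horizonlessMustDrain_at_of_completeDevelopment`.)
[folklore] -/
theorem cruxInstance_of_completeSector_of_completeDevelopment (hC : Sig.stub_completeSector)
    {X : Type} [TopologicalSpace X] [ChartedSpace E3 X] [IsManifold (𝓡 3) ∞ X] [T2Space X] [SecondCountableTopology X]
    [ConnectedSpace X] {D : InitialDataSet (𝓡 3) X} (hD : D ∈ admissibleVacuumData X)
    (hc : ∃ 𝒟c : VacuumCauchyDevelopment D, ∀ [𝒟c.metric.toPseudoRiemannianMetric.HasLeviCivita],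
      IsGeodesicallyComplete 𝒟c.metric.toPseudoRiemannianMetric.leviCivita)
    (𝒟 : VacuumCauchyDevelopment D) (hmax : 𝒟.IsMaximal)
    (hscri : Summit.FinalStateConjecture.HasCompleteNullInfinity 𝒟.toCauchyDevelopment)
    (hH : ¬ ∀ [𝒟.metric.HasLeviCivita], ∃ q : 𝒟.carrier, ∀ (p : X) (γ : ℝ → 𝒟.carrier) (dom : Set ℝ),
      𝒟.metric.IsNormalisedNullRayFrom 𝒟.timeOrientation 𝒟.embed 𝒟.normal p γ dom → ¬ BddAbove dom →
        q ∉ 𝒟.metric.chronologicalPast 𝒟.timeOrientation (γ '' (dom ∩ Set.Ici 0))) :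
    𝒟.toCauchyDevelopment.HasVanishingFinalBondiMass := by
  by_cases hcomp : (∀ [𝒟.metric.HasLeviCivita], ¬ 𝒟.metric.IsFutureNullGeodesicallyIncomplete 𝒟.timeOrientation ∧
      ¬ 𝒟.metric.IsFutureTimelikeGeodesicallyIncomplete 𝒟.timeOrientation)
  · exact hC X D hD 𝒟 hmax hcomp
  · exact stub_incompleteSectorFibre X D hD hc 𝒟 hmax hscri hH hcomp

/-- **Penrose's theorem from the registered stubs and `TrappedImpliesMassive`** (kernel check of TRP against the legend): the two
sectors give the crux (`HorizonlessMustDrain_of`), which with route NoNullFinalMomentum's crux (verbatim hypothesis) hides every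
closed trapped surface of a censored MGHD behind an event horizon. Hawking–Ellis 1973, Prop. 9.2.1. [cite: HawkingEllis1973, §9.2, Prop. 9.2.1] -/
theorem trappedHasHorizon_of_stubs (hC : Sig.stub_completeSector) (hI : Sig.stub_incompleteSector)
    (hT : ∀ (X : Type) [TopologicalSpace X] [ChartedSpace E3 X] [IsManifold (𝓡 3) ∞ X] [T2Space X]
      [SecondCountableTopology X] [ConnectedSpace X],
      ∀ D ∈ admissibleVacuumData X, ∀ 𝒟 : VacuumCauchyDevelopment D, 𝒟.IsMaximal →
        Summit.FinalStateConjecture.HasCompleteNullInfinity 𝒟.toCauchyDevelopment →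
        (∀ [𝒟.metric.HasLeviCivita], ∃ f : Metric.sphere (0 : E3) 1 → 𝒟.carrier,
          range f ⊆ 𝒟.metric.causalFuture 𝒟.timeOrientation (range 𝒟.embed) ∧
            𝒟.metric.IsTrappedSurface (𝓡 2) 𝒟.timeOrientation f) →
        ¬ 𝒟.toCauchyDevelopment.HasVanishingFinalBondiMass)
    {X : Type} [TopologicalSpace X] [ChartedSpace E3 X] [IsManifold (𝓡 3) ∞ X] [T2Space X] [SecondCountableTopology X]
    [ConnectedSpace X] {D : InitialDataSet (𝓡 3) X} (hD : D ∈ admissibleVacuumData X)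
    (𝒟 : VacuumCauchyDevelopment D) (hmax : 𝒟.IsMaximal)
    (hscri : Summit.FinalStateConjecture.HasCompleteNullInfinity 𝒟.toCauchyDevelopment)
    (htrap : ∀ [𝒟.metric.HasLeviCivita], ∃ f : Metric.sphere (0 : E3) 1 → 𝒟.carrier,
      range f ⊆ 𝒟.metric.causalFuture 𝒟.timeOrientation (range 𝒟.embed) ∧
        𝒟.metric.IsTrappedSurface (𝓡 2) 𝒟.timeOrientation f) :
    ∀ [𝒟.metric.HasLeviCivita], ∃ q : 𝒟.carrier, ∀ (p : X) (γ : ℝ → 𝒟.carrier) (dom : Set ℝ),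
      𝒟.metric.IsNormalisedNullRayFrom 𝒟.timeOrientation 𝒟.embed 𝒟.normal p γ dom → ¬ BddAbove dom →
        q ∉ 𝒟.metric.chronologicalPast 𝒟.timeOrientation (γ '' (dom ∩ Set.Ici 0)) :=
  stub_trappedHasHorizon_of_cruxes (HorizonlessMustDrain_of hC hI) hT X D hD 𝒟 hmax hscri htrap

end SectorTier

/-! ## Dynamics tier (lead c7, 2026-08-17): the incomplete sector needs the vacuum equations — C forces "null complete ⇒ timelike complete"

Why no stub-worker can close the registered `stub_incompleteSector` over the present tree (the structural reason behind the c5 verdict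
`stub-blocked: none`): by W3/W6 both hypotheses of statement C are consequences of future NULL geodesic completeness on every Cauchy
development, so C says in particular "future null complete ⇒ future timelike complete" — for vacuum MGHDs of admissible data a global
statement about the Einstein flow, and for GENERAL Cauchy developments of admissible data a FALSE statement: Geroch's conformally
rescaled Minkowski space `Ω² η` (`Ω = 1` off the world-tube `{|x| ≤ 1}` and for `t ≤ 2`, `Ω(t,x) = Ω(t,−x)`, `t² Ω → 0` along the
`t`-axis; Geroch 1968b, Hawking–Ellis 1973 §8.1 p. 258) is a Cauchy development of the trivial admissible datum with Minkowski's causal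
structure, null geodesically complete, with a future-incomplete timelike geodesic (the axis).  So the emptiness of the incomplete
sector can only come from `isRicciFlat` / `IsMaximal`, of which the tree derives no global consequence.  Registered as two glue stubs
(pure logic over W3/W6; to land `--supports`):

* DYN-V `stub_timelikeComplete_of_nullComplete_of_C` — C (verbatim `Sig.horizonlessComplete`) ⇒ every future null geodesically complete
  maximal vacuum Cauchy development of an admissible datum is future timelike geodesically complete;
* DYN-C `stub_timelikeComplete_of_nullComplete_of_cauchyC` — C read over ALL Cauchy developments of admissible data ⇒ the same for every
  such Cauchy development (refuted on paper by Geroch's development, which the tree does not yet construct). -/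

section DynamicsTier

/-- DYN-V (registered glue stub, lead c7): **statement C makes "future null complete ⇒ future timelike complete" a theorem about vacuum
MGHDs of admissible data** (W6 + W3 supply C's hypotheses from null completeness). Hawking–Ellis 1973, §8.1, p. 258.
[cite: HawkingEllis1973, §8.1, p. 258] -/
theorem stub_timelikeComplete_of_nullComplete_of_C : open scoped Manifold in (∀ (X : Type) [TopologicalSpace X] [ChartedSpace Literature.Geometry.Lorentzian.E3 X] [IsManifold (𝓡 3) ((⊤ : ℕ∞) : WithTop ℕ∞) X] [T2Space X] [SecondCountableTopology X] [ConnectedSpace X], ∀ D ∈ Literature.Geometry.Lorentzian.admissibleVacuumData X, ∀ 𝒟 : Literature.Geometry.Lorentzian.VacuumCauchyDevelopment D, 𝒟.IsMaximal → Summit.FinalStateConjecture.HasCompleteNullInfinity 𝒟.toCauchyDevelopment → ¬ (∀ [𝒟.metric.HasLeviCivita], ∃ q : 𝒟.carrier, ∀ (p : X) (γ : ℝ → 𝒟.carrier) (dom : Set ℝ), 𝒟.metric.IsNormalisedNullRayFrom 𝒟.timeOrientation 𝒟.embed 𝒟.normal p γ dom → ¬ BddAbove dom → q ∉ 𝒟.metric.chronologicalPast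 𝒟.timeOrientation (γ '' (dom ∩ Set.Ici 0))) → ∀ [𝒟.metric.HasLeviCivita], ¬ 𝒟.metric.IsFutureNullGeodesicallyIncomplete 𝒟.timeOrientation ∧ ¬ 𝒟.metric.IsFutureTimelikeGeodesicallyIncomplete 𝒟.timeOrientation) → ∀ (X : Type) [TopologicalSpace X] [ChartedSpace Literature.Geometry.Lorentzian.E3 X] [IsManifold (𝓡 3) ((⊤ : ℕ∞) : WithTop ℕ∞) X] [T2Space X] [SecondCountableTopology X] [ConnectedSpace X], ∀ D ∈ Literature.Geometry.Lorentzian.admissibleVacuumData X, ∀ 𝒟 : Literature.Geometry.Lorentzian.VacuumCauchyDevelopment D, 𝒟.IsMaximal → (∀ [𝒟.metric.HasLeviCivita], ¬ 𝒟.metric.IsFutureNullGeodesicallyIncomplete 𝒟.timeOrientation) → ∀ [𝒟.metric.HasLeviCivita], ¬ 𝒟.metric.IsFutureTimelikeGeodesicallyIncomplete 𝒟.timeOrientation := by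
  sorry

/-- DYN-C (registered glue stub, lead c7): **C read over ALL Cauchy developments of admissible data forces "future null complete ⇒
future timelike complete" for every such Cauchy development** — false by Geroch's example (Geroch 1968b; Hawking–Ellis 1973, §8.1,
p. 258), so C needs the vacuum equations / maximality. [cite: HawkingEllis1973, §8.1, p. 258] -/
theorem stub_timelikeComplete_of_nullComplete_of_cauchyC : open scoped Manifold in (∀ (X : Type) [TopologicalSpace X] [ChartedSpace Literature.Geometry.Lorentzian.E3 X] [IsManifold (𝓡 3) ((⊤ : ℕ∞) : WithTop ℕ∞) X] [T2Space X] [SecondCountableTopology X] [ConnectedSpace X], ∀ D ∈ Literature.Geometry.Lorentzian.admissibleVacuumData X, ∀ 𝒟 : Literature.Geometry.Lorentzian.CauchyDevelopment D, Summit.FinalStateConjecture.HasCompleteNullInfinity 𝒟 → ¬ (∀ [𝒟.metric.HasLeviCivita], ∃ q : 𝒟.carrier, ∀ (p : X) (γ : ℝ → 𝒟.carrier) (dom : Set ℝ), 𝒟.metric.IsNormalisedNullRayFrom 𝒟.timeOrientation 𝒟.embed 𝒟.normal p γ dom → ¬ BddAbove dom → q ∉ 𝒟.metric.chronologicalPast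 𝒟.timeOrientation (γ '' (dom ∩ Set.Ici 0))) → ∀ [𝒟.metric.HasLeviCivita], ¬ 𝒟.metric.IsFutureNullGeodesicallyIncomplete 𝒟.timeOrientation ∧ ¬ 𝒟.metric.IsFutureTimelikeGeodesicallyIncomplete 𝒟.timeOrientation) → ∀ (X : Type) [TopologicalSpace X] [ChartedSpace Literature.Geometry.Lorentzian.E3 X] [IsManifold (𝓡 3) ((⊤ : ℕ∞) : WithTop ℕ∞) X] [T2Space X] [SecondCountableTopology X] [ConnectedSpace X], ∀ D ∈ Literature.Geometry.Lorentzian.admissibleVacuumData X, ∀ 𝒟 : Literature.Geometry.Lorentzian.CauchyDevelopment D, (∀ [𝒟.metric.HasLeviCivita], ¬ 𝒟.metric.IsFutureNullGeodesicallyIncomplete 𝒟.timeOrientation) → ∀ [𝒟.metric.HasLeviCivita], ¬ 𝒟.metric.IsFutureTimelikeGeodesicallyIncomplete 𝒟.timeOrientation := by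
  sorry

/-- **C forces "null complete ⇒ timelike complete" on vacuum MGHDs** (kernel check of DYN-V against the legend `Sig.horizonlessComplete`).
[folklore] -/
theorem timelikeComplete_of_nullComplete_of_horizonlessComplete (hC : Sig.horizonlessComplete)
    {X : Type} [TopologicalSpace X] [ChartedSpace E3 X] [IsManifold (𝓡 3) ∞ X] [T2Space X] [SecondCountableTopology X]
    [ConnectedSpace X] {D : InitialDataSet (𝓡 3) X} (hD : D ∈ admissibleVacuumData X)
    (𝒟 : VacuumCauchyDevelopment D) (hmax : 𝒟.IsMaximal)
    (hN : ∀ [𝒟.metric.HasLeviCivita], ¬ 𝒟.metric.IsFutureNullGeodesicallyIncomplete 𝒟.timeOrientation) :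
    ∀ [𝒟.metric.HasLeviCivita], ¬ 𝒟.metric.IsFutureTimelikeGeodesicallyIncomplete 𝒟.timeOrientation :=
  stub_timelikeComplete_of_nullComplete_of_C hC X D hD 𝒟 hmax hN

/-- **(★) forces it too** ((★) ⇒ C1 ⇒ C ⇒ DYN-V): "visible incompleteness is naked" already implies "future null complete ⇒ future
timelike complete" for vacuum MGHDs of admissible data — so (★) is a vacuum-dynamics statement as well. [folklore] -/
theorem timelikeComplete_of_nullComplete_of_naked (h : Sig.visibleIncompleteIsNaked)
    {X : Type} [TopologicalSpace X] [ChartedSpace E3 X] [IsManifold (𝓡 3) ∞ X] [T2Space X] [SecondCountableTopology X]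
    [ConnectedSpace X] {D : InitialDataSet (𝓡 3) X} (hD : D ∈ admissibleVacuumData X)
    (𝒟 : VacuumCauchyDevelopment D) (hmax : 𝒟.IsMaximal)
    (hN : ∀ [𝒟.metric.HasLeviCivita], ¬ 𝒟.metric.IsFutureNullGeodesicallyIncomplete 𝒟.timeOrientation) :
    ∀ [𝒟.metric.HasLeviCivita], ¬ 𝒟.metric.IsFutureTimelikeGeodesicallyIncomplete 𝒟.timeOrientation :=
  timelikeComplete_of_nullComplete_of_horizonlessComplete (horizonlessComplete_of_hidden (hidden_of_naked h)) hD 𝒟 hmax hN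

end DynamicsTier

end Summit.FinalStateConjecture.FinalStateConjecture.Cruxes.HorizonlessMustDrain.Birth

end
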